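import Mathlib
import HarnessLib

/-!
# Route `KLProgramme`, crux K3 — engine-flow child (stmt-HubbardSuperconductivity-20437), stub (C) at `n = 0`, located item #22a «(C)-SCALE0-PT2»,
# β-layer §2c: the «β-WINDOW REDUCTION» for image-sum majorants — `I(kβ) ≤ I(β)` and `sup_{β ≥ β₀} I = sup_{[β₀, 2β₀)} I`

Cell gate-hubbard-kl, seat p1 g19 (supplier of #22a's L/β layers; located finding «β-WINDOW REDUCTION», KL STATUS 2026-08-28 08:39Z).  The β-layer of
record (k3c5-p1's SCALE0-PT2-CERT-SPEC-v2 §2c, route II-maj) bounds the fermionic covariance through the antiperiodic images of the `β = ∞` kernel,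
`|C_β(x⃗,τ)| ≤ E_β(τ) := Σ_{m ∈ ℤ} p(τ + mβ)` with `p ≥ 0` a profile of `|C_∞(x⃗,·)|` (`Literature.Analysis.Fourier.FermionicPoissonSummation`), and the sunset
moments through `I(β) := ∫₀^β E_β(τ)² Ē_β(τ) dτ`, `Ē_β` the periodisation of the reflected conjugate profile.  A certificate needs `I(β) ≤ S` for EVERY
`β ≥ β₀ = klBetaMin`.  This file proves, for ARBITRARY nonnegative measurable profiles (no monotone hull, no evenness, no decay hypothesis; values in `ℝ≥0∞` so that no
summability/integrability side condition arises):

* §1 `tsum_profile_eq_sum_tsum` — the periodisation identity `E_β(τ) = Σ_{j<k} E_{kβ}(τ + jβ)` (re-index `m = qk + j`, Mathlib `Int.divModEquiv`);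
* §2 `prod_three_sum_ge_sum_diag` — `(Σ_j a_j)(Σ_j b_j)(Σ_j c_j) ≥ Σ_j a_j b_j c_j` for nonnegatives;
* §3 `setLIntegral_Ioc_comp_add`, `setLIntegral_Ioc_sum_shift_eq` — `∫_{(0,β]} Σ_{j<k} F(τ + jβ) dτ = ∫_{(0,kβ]} F`;
* §4 **`sunsetMajorant_mul_le`** — `I(kβ) ≤ I(β)` for every integer `k ≥ 1` and every `β > 0`, for the three-profile functional
  `I(β) = ∫_{(0,β]} E^{p₁}_β E^{p₂}_β E^{p₃}_β` (the sunset case is `p₁ = p₂ = p`, `p₃ = q`);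
* §5 **`sunsetMajorant_le_of_window`** — hence `(∀ β ∈ [β₀, 2β₀), I(β) ≤ S) → ∀ β′ ≥ β₀, I(β′) ≤ S` (`β′ = kβ`, `k = ⌊β′/β₀⌋`, `β = β′/k ∈ [β₀, 2β₀)`):
  β-uniformity over `[β₀, ∞)` costs ONE OCTAVE of certification and no asymptotic layer; no monotonicity-in-β lemma is needed (termwise monotonicity of the
  image correlations is false for asymmetric particle/hole profiles).

Pure measure theory; nothing here asserts (C), any stub of 20437, K3 or superconductivity.  No definitions (the functional is written out in each statement).
References: the image representation — Fetter–Walecka §25 / `FermionicPoissonSummation`; the superadditivity device is elementary.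
-/

noncomputable section

namespace Summit.HubbardSuperconductivity.HubbardSuperconductivity.Theorems.KLRegimeSplit

set_option linter.dupNamespace false -- summit = problem name (single-conjunct summit), D-0017

open MeasureTheory Set Finset
open scoped ENNReal

/-! ## §1 The periodisation identity `E_β(τ) = Σ_{j<k} E_{kβ}(τ + jβ)` -/

/-- **Re-indexing the images mod `k`**: for `k ≥ 1`, `Σ_{m ∈ ℤ} p(τ + mβ) = Σ_{j<k} Σ_{q ∈ ℤ} p(τ + jβ + q(kβ))` (every profile `p : ℝ → ℝ≥0∞`;
`m = qk + j`, Mathlib `Int.divModEquiv`). -/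
theorem tsum_profile_eq_sum_tsum (p : ℝ → ℝ≥0∞) (β τ : ℝ) (k : ℕ) [NeZero k] :
    ∑' m : ℤ, p (τ + m * β) = ∑ j : Fin k, ∑' q : ℤ, p (τ + (j : ℕ) * β + q * ((k : ℝ) * β)) := by
  rw [← (Int.divModEquiv k).symm.tsum_eq (fun m : ℤ => p (τ + m * β)), ENNReal.tsum_prod', ENNReal.tsum_comm,
    ← tsum_fintype (L := SummationFilter.unconditional _)]
  refine tsum_congr fun j => tsum_congr fun q => ?_
  simp only [Int.divModEquiv, Equiv.coe_fn_symm_mk]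
  congr 1
  push_cast
  ring

/-! ## §2 Dropping the cross terms -/

/-- **`(Σ_j a_j)(Σ_j b_j)(Σ_j c_j) ≥ Σ_j a_j b_j c_j`** for nonnegative families (keep the diagonal of the expansion). -/
theorem prod_three_sum_ge_sum_diag {ι : Type*} (s : Finset ι) (a b c : ι → ℝ≥0∞) :
    ∑ j ∈ s, a j * b j * c j ≤ (∑ j ∈ s, a j) * (∑ j ∈ s, b j) * (∑ j ∈ s, c j) := by
  calc ∑ j ∈ s, a j * b j * c j ≤ ∑ j ∈ s, a j * (∑ i ∈ s, b i) * (∑ i ∈ s, c i) :=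
        Finset.sum_le_sum fun j hj =>
          mul_le_mul' (mul_le_mul' le_rfl (Finset.single_le_sum (f := b) (fun _ _ => bot_le) hj))
            (Finset.single_le_sum (f := c) (fun _ _ => bot_le) hj)
    _ = (∑ j ∈ s, a j) * (∑ j ∈ s, b j) * (∑ j ∈ s, c j) := by rw [Finset.sum_mul, Finset.sum_mul]

/-! ## §3 Shifting and concatenating the integration cells -/

/-- Translating a set integral over `(0, β]`: `∫_{(0,β]} F(τ + c) dτ = ∫_{(c, c+β]} F`. -/
theorem setLIntegral_Ioc_comp_add (F : ℝ → ℝ≥0∞) (β c : ℝ) :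
    ∫⁻ τ in Ioc 0 β, F (τ + c) = ∫⁻ τ in Ioc c (c + β), F τ := by
  rw [← lintegral_indicator measurableSet_Ioc, ← lintegral_indicator measurableSet_Ioc]
  have h : (fun τ : ℝ => (Ioc 0 β).indicator (fun τ => F (τ + c)) τ) = fun τ => (Ioc c (c + β)).indicator F (τ + c) := by
    funext τ
    by_cases hτ : τ ∈ Ioc 0 β
    · rw [indicator_of_mem hτ, indicator_of_mem]
      exact ⟨by linarith [hτ.1], by linarith [hτ.2]⟩
    · rw [indicator_of_notMem hτ, indicator_of_notMem]
      intro h'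
      exact hτ ⟨by linarith [h'.1], by linarith [h'.2]⟩
  rw [h]
  exact lintegral_add_right_eq_self (μ := (volume : Measure ℝ)) (fun τ => (Ioc c (c + β)).indicator F τ) c

/-- **Concatenation**: `Σ_{j<k} ∫_{(jβ, (j+1)β]} F = ∫_{(0, kβ]} F` for `β ≥ 0`. -/
theorem sum_setLIntegral_Ioc_eq (F : ℝ → ℝ≥0∞) {β : ℝ} (hβ : 0 ≤ β) :
    ∀ k : ℕ, ∑ j ∈ Finset.range k, ∫⁻ τ in Ioc ((j : ℝ) * β) ((j : ℝ) * β + β), F τ = ∫⁻ τ in Ioc 0 ((k : ℝ) * β), F τ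
  | 0 => by simp
  | k + 1 => by
    rw [Finset.sum_range_succ, sum_setLIntegral_Ioc_eq F hβ k]
    have hdisj : Disjoint (Set.Ioc (0 : ℝ) (k * β)) (Set.Ioc ((k : ℝ) * β) (k * β + β)) :=
      Set.disjoint_left.2 fun τ h1 h2 => absurd (lt_of_lt_of_le h2.1 h1.2) (lt_irrefl _)
    have hcast : (((k + 1 : ℕ)) : ℝ) * β = (k : ℝ) * β + β := by push_cast; ring
    rw [hcast, ← lintegral_union measurableSet_Ioc hdisj,
      Set.Ioc_union_Ioc_eq_Ioc (by positivity) (by linarith)]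

/-- **`∫_{(0,β]} Σ_{j<k} F(τ + jβ) dτ = ∫_{(0,kβ]} F`** for measurable `F` and `β ≥ 0`. -/
theorem setLIntegral_Ioc_sum_shift_eq (F : ℝ → ℝ≥0∞) (hF : Measurable F) {β : ℝ} (hβ : 0 ≤ β) (k : ℕ) :
    ∫⁻ τ in Ioc 0 β, ∑ j ∈ Finset.range k, F (τ + (j : ℝ) * β) = ∫⁻ τ in Ioc 0 ((k : ℝ) * β), F τ := by
  rw [lintegral_finsetSum (Finset.range k) (f := fun (j : ℕ) (τ : ℝ) => F (τ + (j : ℝ) * β))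
    (fun j _ => hF.comp (measurable_add_const _)), ← sum_setLIntegral_Ioc_eq F hβ k]
  refine Finset.sum_congr rfl fun j _ => ?_
  rw [setLIntegral_Ioc_comp_add]

/-! ## §4 The superadditivity inequality `I(kβ) ≤ I(β)` -/

/-- Measurability of a periodised profile. -/
theorem measurable_tsum_profile {p : ℝ → ℝ≥0∞} (hp : Measurable p) (γ : ℝ) :
    Measurable fun τ : ℝ => ∑' m : ℤ, p (τ + m * γ) :=
  Measurable.tsum fun _ => hp.comp (measurable_add_const _)

/-- **β-WINDOW REDUCTION, the inequality**: for nonnegative measurable profiles `p₁, p₂, p₃ : ℝ → ℝ≥0∞`, every `β > 0` and every integer `k ≥ 1`,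
`∫_{(0,kβ]} E^{p₁}_{kβ} E^{p₂}_{kβ} E^{p₃}_{kβ} ≤ ∫_{(0,β]} E^{p₁}_β E^{p₂}_β E^{p₃}_β`, `E^{p}_γ(τ) = Σ_{m ∈ ℤ} p(τ + mγ)` — the image-sum majorant functional
at the `k`-fold period is dominated by the functional at the period itself (the sunset case: `p₁ = p₂ =` profile of `|C_∞(x⃗,·)|`, `p₃ =` reflected conjugate profile). -/
theorem sunsetMajorant_mul_le {p₁ p₂ p₃ : ℝ → ℝ≥0∞} (hp₁ : Measurable p₁) (hp₂ : Measurable p₂) (hp₃ : Measurable p₃)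
    {β : ℝ} (hβ : 0 < β) (k : ℕ) [NeZero k] :
    ∫⁻ τ in Ioc 0 ((k : ℝ) * β), (∑' m : ℤ, p₁ (τ + m * ((k : ℝ) * β))) * (∑' m : ℤ, p₂ (τ + m * ((k : ℝ) * β))) *
        (∑' m : ℤ, p₃ (τ + m * ((k : ℝ) * β))) ≤
      ∫⁻ τ in Ioc 0 β, (∑' m : ℤ, p₁ (τ + m * β)) * (∑' m : ℤ, p₂ (τ + m * β)) * (∑' m : ℤ, p₃ (τ + m * β)) := by
  -- the integrand at the long period
  set G : ℝ → ℝ≥0∞ := fun τ => (∑' m : ℤ, p₁ (τ + m * ((k : ℝ) * β))) * (∑' m : ℤ, p₂ (τ + m * ((k : ℝ) * β))) *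
    (∑' m : ℤ, p₃ (τ + m * ((k : ℝ) * β))) with hG
  have hGm : Measurable G :=
    ((measurable_tsum_profile hp₁ _).mul (measurable_tsum_profile hp₂ _)).mul (measurable_tsum_profile hp₃ _)
  -- rewrite the left side as `∫_{(0,β]} Σ_j G(τ + jβ)`
  have hL : ∫⁻ τ in Ioc 0 ((k : ℝ) * β), G τ = ∫⁻ τ in Ioc 0 β, ∑ j ∈ Finset.range k, G (τ + (j : ℝ) * β) :=
    (setLIntegral_Ioc_sum_shift_eq G hGm hβ.le k).symm
  change ∫⁻ τ in Ioc 0 ((k : ℝ) * β), G τ ≤ _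
  rw [hL]
  refine lintegral_mono fun τ => ?_
  -- pointwise: `Σ_j G(τ + jβ) ≤ (Σ_j A_j)(Σ_j B_j)(Σ_j C_j) = E₁ E₂ E₃`
  rw [tsum_profile_eq_sum_tsum p₁ β τ k, tsum_profile_eq_sum_tsum p₂ β τ k, tsum_profile_eq_sum_tsum p₃ β τ k,
    Finset.sum_range]
  refine le_trans (le_of_eq ?_) (prod_three_sum_ge_sum_diag (Finset.univ : Finset (Fin k)) _ _ _)
  refine Finset.sum_congr rfl fun j _ => ?_
  simp only [hG, add_assoc]

/-! ## §5 The window corollary: one octave certifies all `β ≥ β₀` -/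

/-- Every `β′ ≥ β₀ > 0` is an integer multiple `k·β` of some `β ∈ [β₀, 2β₀)` (`k = ⌊β′/β₀⌋`). -/
theorem exists_nat_mul_mem_window {β₀ β' : ℝ} (hβ₀ : 0 < β₀) (h : β₀ ≤ β') :
    ∃ k : ℕ, 0 < k ∧ β₀ ≤ β' / k ∧ β' / k < 2 * β₀ := by
  set k := ⌊β' / β₀⌋₊ with hk
  have hr : 1 ≤ β' / β₀ := by rw [le_div_iff₀ hβ₀]; linarith
  have hk1 : 1 ≤ k := by rw [hk]; exact Nat.one_le_floor_iff _ |>.2 hr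
  have hkpos : (0 : ℝ) < k := by exact_mod_cast hk1
  refine ⟨k, hk1, ?_, ?_⟩
  · rw [le_div_iff₀ hkpos]
    have h1 : (k : ℝ) ≤ β' / β₀ := Nat.floor_le (by positivity)
    calc β₀ * k ≤ β₀ * (β' / β₀) := mul_le_mul_of_nonneg_left h1 hβ₀.le
      _ = β' := mul_div_cancel₀ _ hβ₀.ne'
  · rw [div_lt_iff₀ hkpos]
    have h2 : β' / β₀ < k + 1 := Nat.lt_floor_add_one _
    have hk1' : (1 : ℝ) ≤ k := by exact_mod_cast hk1
    have h3 : (k : ℝ) + 1 ≤ 2 * k := by linarith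
    calc β' = β₀ * (β' / β₀) := (mul_div_cancel₀ _ hβ₀.ne').symm
      _ < β₀ * (k + 1) := mul_lt_mul_of_pos_left h2 hβ₀
      _ ≤ β₀ * (2 * k) := mul_le_mul_of_nonneg_left h3 hβ₀.le
      _ = 2 * β₀ * k := by ring

/-- **β-WINDOW REDUCTION**: if the image-sum majorant functional is certified on ONE OCTAVE, `I(β) ≤ S` for `β ∈ [β₀, 2β₀)`, then `I(β′) ≤ S` for EVERY
`β′ ≥ β₀` (`I(β′) = I(kβ) ≤ I(β)` with `β = β′/k` in the window).  No monotonicity of `I` in `β` is used or claimed. -/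
theorem sunsetMajorant_le_of_window {p₁ p₂ p₃ : ℝ → ℝ≥0∞} (hp₁ : Measurable p₁) (hp₂ : Measurable p₂) (hp₃ : Measurable p₃)
    {β₀ : ℝ} (hβ₀ : 0 < β₀) {S : ℝ≥0∞}
    (hS : ∀ β : ℝ, β₀ ≤ β → β < 2 * β₀ →
      ∫⁻ τ in Ioc 0 β, (∑' m : ℤ, p₁ (τ + m * β)) * (∑' m : ℤ, p₂ (τ + m * β)) * (∑' m : ℤ, p₃ (τ + m * β)) ≤ S)
    {β' : ℝ} (hβ' : β₀ ≤ β') :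
    ∫⁻ τ in Ioc 0 β', (∑' m : ℤ, p₁ (τ + m * β')) * (∑' m : ℤ, p₂ (τ + m * β')) * (∑' m : ℤ, p₃ (τ + m * β')) ≤ S := by
  obtain ⟨k, hk, hlo, hhi⟩ := exists_nat_mul_mem_window hβ₀ hβ'
  haveI : NeZero k := ⟨Nat.pos_iff_ne_zero.1 hk⟩
  have hkpos : (0 : ℝ) < k := by exact_mod_cast hk
  have hβ : 0 < β' / k := lt_of_lt_of_le hβ₀ hlo
  have hrw : β' = (k : ℝ) * (β' / k) := by field_simp
  have key := sunsetMajorant_mul_le hp₁ hp₂ hp₃ hβ k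
  rw [← hrw] at key
  exact key.trans (hS _ hlo hhi)

/-! ## §6 (append, p1 g19) The sunset shape `E_β(τ)²·Ē_β(β − τ)`: the reflected third leg is again a periodisation at `τ`

The II-maj functional is written with the third leg evaluated at the antiperiodic partner point, `Ē_β(β − τ) = Σ_m q(β − τ + mβ)` (`q` a profile of
`|C_∞(−x⃗, ·)|`).  Re-indexing `m ↦ −m−1` shows `Σ_m q(β − τ + mβ) = Σ_m q̃(τ + mβ)` with the REFLECTED profile `q̃(t) := q(−t)`, so §4–§5 apply verbatim
with `p₃ := q̃` (referee ref-3's checklist (c3), KL STATUS 2026-08-28 08:42Z). -/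

/-- **Reflection of the third leg**: `Σ_{m ∈ ℤ} q(β − τ + mβ) = Σ_{m ∈ ℤ} q(−(τ + mβ))` (re-index `m ↦ −m − 1`). -/
theorem tsum_profile_reflect (q : ℝ → ℝ≥0∞) (β τ : ℝ) :
    ∑' m : ℤ, q (β - τ + m * β) = ∑' m : ℤ, q (-(τ + m * β)) := by
  rw [← ((Equiv.neg ℤ).trans (Equiv.subRight (1 : ℤ))).tsum_eq (fun m : ℤ => q (-(τ + m * β)))]
  refine tsum_congr fun m => ?_
  simp only [Equiv.trans_apply, Equiv.neg_apply, Equiv.subRight_apply]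
  congr 1
  push_cast
  ring

/-- **β-WINDOW REDUCTION, sunset shape — the inequality**: for nonnegative measurable `p, q : ℝ → ℝ≥0∞`, `β > 0`, `k ≥ 1`:
`∫_{(0,kβ]} E^{p}_{kβ}(τ)² · E^{q}_{kβ}(kβ − τ) dτ ≤ ∫_{(0,β]} E^{p}_β(τ)² · E^{q}_β(β − τ) dτ`, `E^{p}_γ(τ) = Σ_m p(τ + mγ)`. -/
theorem sunsetShape_mul_le {p q : ℝ → ℝ≥0∞} (hp : Measurable p) (hq : Measurable q) {β : ℝ} (hβ : 0 < β) (k : ℕ) [NeZero k] :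
    ∫⁻ τ in Ioc 0 ((k : ℝ) * β), (∑' m : ℤ, p (τ + m * ((k : ℝ) * β))) ^ 2 * (∑' m : ℤ, q ((k : ℝ) * β - τ + m * ((k : ℝ) * β))) ≤
      ∫⁻ τ in Ioc 0 β, (∑' m : ℤ, p (τ + m * β)) ^ 2 * (∑' m : ℤ, q (β - τ + m * β)) := by
  have hq' : Measurable fun t : ℝ => q (-t) := hq.comp measurable_neg
  simp_rw [tsum_profile_reflect q, sq]
  exact sunsetMajorant_mul_le hp hp hq' hβ k

/-- **β-WINDOW REDUCTION, sunset shape**: if `∫_{(0,β]} E^{p}_β(τ)²·E^{q}_β(β − τ) dτ ≤ S` for every `β ∈ [β₀, 2β₀)` (`β₀ > 0`), then the same holds for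
EVERY `β′ ≥ β₀` — nonnegativity and measurability of the profiles are the only hypotheses (raw `|C_∞|` profiles, oscillation allowed; no hull, no
monotonicity in `β`; `k ∈ ℕ⁺` arbitrary, so the octave covers all real `β′ ≥ β₀`, not only dyadic multiples). -/
theorem sunsetShape_le_of_window {p q : ℝ → ℝ≥0∞} (hp : Measurable p) (hq : Measurable q) {β₀ : ℝ} (hβ₀ : 0 < β₀) {S : ℝ≥0∞}
    (hS : ∀ β : ℝ, β₀ ≤ β → β < 2 * β₀ →
      ∫⁻ τ in Ioc 0 β, (∑' m : ℤ, p (τ + m * β)) ^ 2 * (∑' m : ℤ, q (β - τ + m * β)) ≤ S)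
    {β' : ℝ} (hβ' : β₀ ≤ β') :
    ∫⁻ τ in Ioc 0 β', (∑' m : ℤ, p (τ + m * β')) ^ 2 * (∑' m : ℤ, q (β' - τ + m * β')) ≤ S := by
  have hq' : Measurable fun t : ℝ => q (-t) := hq.comp measurable_neg
  have hS' : ∀ β : ℝ, β₀ ≤ β → β < 2 * β₀ →
      ∫⁻ τ in Ioc 0 β, (∑' m : ℤ, p (τ + m * β)) * (∑' m : ℤ, p (τ + m * β)) * (∑' m : ℤ, (fun t : ℝ => q (-t)) (τ + m * β)) ≤ S := by
    intro β h1 h2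
    have h := hS β h1 h2
    simp_rw [tsum_profile_reflect q, sq] at h
    exact h
  have h := sunsetMajorant_le_of_window hp hp hq' hβ₀ hS' hβ'
  simp_rw [tsum_profile_reflect q, sq]
  exact h

end Summit.HubbardSuperconductivity.HubbardSuperconductivity.Theorems.KLRegimeSplit

end
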